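import Literature.AlgebraicGeometry.Deformation.SmoothSchemeLiftObstructionCriterionGluePullback
import Literature.AlgebraicGeometry.Deformation.FlatDeformationGluedIso
import Literature.AlgebraicGeometry.Morphisms.ProperOfSurjectiveComp
import Literature.AlgebraicGeometry.AbelianSchemes.AbelianSchemeStructureOnLift
import HarnessLib

/-!
# An abelian scheme over `A ⧸ J` lifts to `A` once its transition data lift to COCYCLE-EXACT glue data over `A`
# ([MFK94] Prop. 6.15 ∘ [Hartshorne2010] Thm. 10.2 — the downstream half of the F-11 G1 chain, kernel-composed)

Layer `Literature/AlgebraicGeometry/AbelianSchemes` (theorems only; no definition, no named fact, no instance).  Cell `hodgecm-mathlib`,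
F-11 grandchild `Cruxes/HDel/Lines/F11LiftWithLineBundle` G1 `stub_abelianLift` (integrator MONO-G1, F0P1b-p06 (g0)); this file is the
SORRY-FREE DOWNSTREAM COMPOSITION of the chain, by name over ★ files of the B-p21 glue lineage, ★ c2c, ★ properness and ★ the junction:

**`AbelianSchemeOver.exists_lift_of_reducing_glueData`.**  `A` Artin local, `k → A` a `k`-algebra structure, `J ≠ ⊤` with `𝔪·J = 0`,
`π' : A ⧸ J → k` a `k`-retraction with nilpotent kernel; `A₀` an abelian scheme of relative dimension `g` over `Spec (A ⧸ J)` (section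
algebras `instΓA`∕`halgA`); `X/k` smooth (section algebras `instΓ`∕`halg`) with `i₀ : X → A₀.X`; a principal affine cover `U'` of `A₀.X`
covering it, `U j = i₀⁻¹ U' j` principal; chart data `e, ε₁, ε₂` of `A₀.X` on it tied to `A₀.X` through `i₀` (★ c2b's output shape
`he hε₁ hε₂`), the transition data `φ j l = transition (ε₁ j l) (ε₂ j l)` admissible modulo a nilpotent `𝔫₀` and cocycle-exact
(`hφ hcocφ`); and COCYCLE-EXACT admissible glue data `ψ₁` over `A` (`hψ₁ hcoc₁`, modulo a nilpotent `𝔫`) REDUCING to `φ` along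
`A → A ⧸ J` (`hψσ`).  THEN there is an abelian scheme `𝒳` of relative dimension `g` over `Spec A` and a cartesian `G : A₀.X → 𝒳.X` over
`Spec (A ⧸ J) → Spec A` compatible with the group laws (★ `IsBaseChangeVia`).  Proof = ★ `existsUnique_structureMap` ∕ ★
`smooth_structureMap` (the glued smooth `A`-scheme `Glue_A(ψ₁)`), ★ `exists_glued_iso_of_transition` (`Ψ : Glue_{A⧸J}(φ) ≅ A₀.X`), ★
`exists_baseChangeMap_isPullback` (`Φ : Glue_{A⧸J}(φ) → Glue_A(ψ₁)` cartesian), `G := Ψ⁻¹ ≫ Φ`, ★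
`isProper_of_isPullback_specMap_quotientMk_of_ne_top` (proper), ★ `exists_abelianSchemeOver_of_isPullback` ([MFK94] Prop. 6.15: the
group law lifts).  §0 records the two-line REDUCTION LEMMA used upstream (a `J`-congruent modification of glue data reduces to the same
data modulo `J`).  HC_CM is proved only modulo the 7 printed citations until rung 0 closes; nothing here is about HC.

## References
* [MumfordFogartyKirwan1994] D. Mumford, J. Fogarty, F. Kirwan, *Geometric Invariant Theory*, 3rd ed. (1994): Ch. 6 §3 Prop. 6.15 (p. 124)
  and its proof (p. 125).
* [Hartshorne2010] R. Hartshorne, *Deformation Theory*, GTM 257 (2010): Thm. 10.2 and its proof (p. 81).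
-/

noncomputable section

set_option backward.isDefEq.respectTransparency false

open CategoryTheory CategoryTheory.Limits AlgebraicGeometry Opposite TopologicalSpace
open scoped TensorProduct

/-! ## §0 Reduction of `J`-congruent glue data -/

namespace Literature.AlgebraicGeometry.Deformation

open SmoothAffineDeformation

/-- `(mk_J ⊗ id)` kills `J · (A ⊗_k B)` (★ `reductionHom_eq_zero_iff` at `π' := mk_J`). [cite: Hartshorne2010, Thm. 10.2 (proof), p. 81] -/
theorem map_mkₐ_eq_zero_of_mem_smul_top {A : Type} [CommRing A] {k : Type} [Field k] [Algebra k A] {J : Ideal A}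
    {B : Type} [CommRing B] [Algebra k B] {x : A ⊗[k] B} (hx : x ∈ J • (⊤ : Submodule A (A ⊗[k] B))) :
    Algebra.TensorProduct.map (Ideal.Quotient.mkₐ k J) (AlgHom.id k B) x = 0 := by
  change reductionHom (Ideal.Quotient.mkₐ k J) B x = 0
  rw [reductionHom_eq_zero_iff _ (Ideal.Quotient.mkₐ_surjective k J)]
  have hker : RingHom.ker (Ideal.Quotient.mkₐ k J) = J := Ideal.Quotient.mkₐ_ker k J
  rw [hker]
  exact hx

/-- **A `J`-congruent modification reduces to the same data**: if `ψ` reduces to `φ` along `mk_J ⊗ id` and `ψ₁ ≡ ψ (mod J)`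
pointwise, then `ψ₁` reduces to `φ` too (the cocycle-exact modification of ★ F3a keeps the reduction of ★ GAP-1).
[cite: Hartshorne2010, Thm. 10.2 (proof), p. 81] -/
theorem map_mkₐ_eq_of_sub_mem_smul_top {A : Type} [CommRing A] {k : Type} [Field k] [Algebra k A] {J : Ideal A}
    {B : Type} [CommRing B] [Algebra k B] (ψ ψ₁ : A ⊗[k] B ≃ₐ[A] A ⊗[k] B)
    (φ : (A ⧸ J) ⊗[k] B ≃ₐ[A ⧸ J] (A ⧸ J) ⊗[k] B)
    (hL : ∀ x, Algebra.TensorProduct.map (Ideal.Quotient.mkₐ k J) (AlgHom.id k B) (ψ x) =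
      φ (Algebra.TensorProduct.map (Ideal.Quotient.mkₐ k J) (AlgHom.id k B) x))
    (hcong : ∀ x, ψ₁ x - ψ x ∈ J • (⊤ : Submodule A (A ⊗[k] B))) (x : A ⊗[k] B) :
    Algebra.TensorProduct.map (Ideal.Quotient.mkₐ k J) (AlgHom.id k B) (ψ₁ x) =
      φ (Algebra.TensorProduct.map (Ideal.Quotient.mkₐ k J) (AlgHom.id k B) x) := by
  rw [← hL x, ← sub_eq_zero, ← map_sub]
  exact map_mkₐ_eq_zero_of_mem_smul_top (hcong x)

end Literature.AlgebraicGeometry.Deformation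

/-! ## §1 The downstream composition -/

namespace Literature.AlgebraicGeometry.AbelianSchemes

open Literature.AlgebraicGeometry.Deformation Literature.AlgebraicGeometry.Morphisms Literature.AlgebraicGeometry.Motives
  Literature.AlgebraicGeometry.Modules Literature.AlgebraicGeometry.HodgeTheory SmoothAffineDeformation

-- one unification in the composition below costs ≈ 2.1e5 heartbeats with the ★ import closure (the same text elaborates at the default
-- when its dependencies are pasted in-file — instance order); the cap is doubled for this one declaration.
set_option maxHeartbeats 400000 in
/-- **An abelian scheme lifts along a small extension once its transition data lift to cocycle-exact glue data reducing to them**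
([MFK94] Prop. 6.15 ∘ [Hartshorne2010] Thm. 10.2, downstream half): glue `ψ₁` to a smooth `A`-scheme (★ FILE 2∕G3), compare its
reduction with `A₀.X` (`Ψ⁻¹ ≫ Φ` cartesian, ★ G5 + ★ c2c), get properness (★) and lift the group law (★ junction).
[cite: MumfordFogartyKirwan1994, Ch. 6 §3 Prop. 6.15 (p. 124) and its proof (p. 125)] [cite: Hartshorne2010, Thm. 10.2 (proof), p. 81] -/
theorem AbelianSchemeOver.exists_lift_of_reducing_glueData
    {A : Type} [CommRing A] [IsArtinianRing A] [IsLocalRing A] {k : Type} [Field k] [Algebra k A]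
    {J : Ideal A} (hJ : J ≠ ⊤) (hmJ : IsLocalRing.maximalIdeal A * J = ⊥)
    (π' : (A ⧸ J) →ₐ[k] k) (hπ'nil : IsNilpotent (RingHom.ker π'))
    (A₀ : AbelianSchemeOver (Spec (.of (A ⧸ J)))) {g : ℕ} (hA₀ : A₀.IsOfRelDim g)
    {X : Over (Spec (CommRingCat.of k))} [Smooth X.hom] [instΓ : ∀ W : X.left.Opens, Algebra k Γ(X.left, W)]
    (halg : ∀ (W : X.left.Opens) (s : k), algebraMap k Γ(X.left, W) s = (constToPresheaf X).app (op W) s)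
    [instΓA : ∀ W : A₀.X.left.Opens, Algebra (A ⧸ J) Γ(A₀.X.left, W)]
    (halgA : ∀ (W : A₀.X.left.Opens) (a : A ⧸ J), algebraMap (A ⧸ J) Γ(A₀.X.left, W) a = (constToPresheaf A₀.X).app (op W) a)
    (i₀ : X.left ⟶ A₀.X.left)
    {ι : Type} (U' : ι → A₀.X.left.affineOpens) (b' : (j l : ι) → Γ(A₀.X.left, (U' j).1))
    (hb' : ∀ j l, (U' j).1 ⊓ (U' l).1 = A₀.X.left.basicOpen (b' j l)) (hU'cov : IsOpenCover fun j => (U' j).1)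
    (U : ι → X.left.affineOpens) (hU : ∀ j, (U j).1 = i₀ ⁻¹ᵁ (U' j).1)
    (b : (j l : ι) → Γ(X.left, (U j).1)) (hb : ∀ j l, (U j).1 ⊓ (U l).1 = X.left.basicOpen (b j l))
    (e : ∀ j, (A ⧸ J) ⊗[k] Γ(X.left, (U j).1) ≃ₐ[A ⧸ J] Γ(A₀.X.left, (U' j).1))
    (he : ∀ j x, i₀.appLE (U' j).1 (U j).1 (hU j).le (e j x) = specialFibreHom π' _ x)
    (ε₁ ε₂ : ∀ j l, (A ⧸ J) ⊗[k] Γ(X.left, (U j).1 ⊓ (U l).1) ≃ₐ[A ⧸ J] Γ(A₀.X.left, (U' j).1 ⊓ (U' l).1))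
    (hε₁ : ∀ j l (a : A ⧸ J) (s : Γ(X.left, (U j).1)),
      ε₁ j l (a ⊗ₜ X.left.presheaf.map (homOfLE inf_le_left).op s) =
        A₀.X.left.presheaf.map (homOfLE inf_le_left).op (e j (a ⊗ₜ s)))
    (hε₂ : ∀ j l (a : A ⧸ J) (s : Γ(X.left, (U l).1)),
      ε₂ j l (a ⊗ₜ X.left.presheaf.map (homOfLE inf_le_right).op s) =
        A₀.X.left.presheaf.map (homOfLE inf_le_right).op (e l (a ⊗ₜ s)))
    (𝔫₀ : Ideal (A ⧸ J)) (h𝔫₀ : IsNilpotent 𝔫₀)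
    (hφ : ∀ j l x, transition (ε₁ j l) (ε₂ j l) x - x ∈
      𝔫₀ • (⊤ : Submodule (A ⧸ J) ((A ⧸ J) ⊗[k] Γ(X.left, (U j).1 ⊓ (U l).1))))
    (hcocφ : ∀ (j l m : ι)
      (Φjl : (A ⧸ J) ⊗[k] Γ(X.left, (U j).1 ⊓ (U l).1) →ₐ[A ⧸ J] (A ⧸ J) ⊗[k] Γ(X.left, (U j).1 ⊓ (U l).1 ⊓ (U m).1))
      (_ : ∀ a s, Φjl (a ⊗ₜ s) = a ⊗ₜ X.left.presheaf.map (homOfLE inf_le_left).op s)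
      (Φlm : (A ⧸ J) ⊗[k] Γ(X.left, (U l).1 ⊓ (U m).1) →ₐ[A ⧸ J] (A ⧸ J) ⊗[k] Γ(X.left, (U j).1 ⊓ (U l).1 ⊓ (U m).1))
      (_ : ∀ a s, Φlm (a ⊗ₜ s) = a ⊗ₜ X.left.presheaf.map
        (homOfLE (le_inf (inf_le_left.trans inf_le_right) inf_le_right)).op s)
      (Φjm : (A ⧸ J) ⊗[k] Γ(X.left, (U j).1 ⊓ (U m).1) →ₐ[A ⧸ J] (A ⧸ J) ⊗[k] Γ(X.left, (U j).1 ⊓ (U l).1 ⊓ (U m).1))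
      (_ : ∀ a s, Φjm (a ⊗ₜ s) = a ⊗ₜ X.left.presheaf.map
        (homOfLE (le_inf (inf_le_left.trans inf_le_left) inf_le_right)).op s)
      (ρjl ρlm ρjm : (A ⧸ J) ⊗[k] Γ(X.left, (U j).1 ⊓ (U l).1 ⊓ (U m).1) ≃ₐ[A ⧸ J]
        (A ⧸ J) ⊗[k] Γ(X.left, (U j).1 ⊓ (U l).1 ⊓ (U m).1)),
      (∀ x, ρjl (Φjl x) = Φjl (transition (ε₁ j l) (ε₂ j l) x)) →
      (∀ x, ρlm (Φlm x) = Φlm (transition (ε₁ l m) (ε₂ l m) x)) →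
      (∀ x, ρjm (Φjm x) = Φjm (transition (ε₁ j m) (ε₂ j m) x)) → ρlm * ρjl = ρjm)
    (ψ₁ : (j l : ι) → A ⊗[k] Γ(X.left, (U j).1 ⊓ (U l).1) ≃ₐ[A] A ⊗[k] Γ(X.left, (U j).1 ⊓ (U l).1))
    (𝔫 : Ideal A) (h𝔫 : IsNilpotent 𝔫)
    (hψ₁ : ∀ j l x, ψ₁ j l x - x ∈ 𝔫 • (⊤ : Submodule A (A ⊗[k] Γ(X.left, (U j).1 ⊓ (U l).1))))
    (hcoc₁ : ∀ (j l m : ι)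
      (Φjl : A ⊗[k] Γ(X.left, (U j).1 ⊓ (U l).1) →ₐ[A] A ⊗[k] Γ(X.left, (U j).1 ⊓ (U l).1 ⊓ (U m).1))
      (_ : ∀ a s, Φjl (a ⊗ₜ s) = a ⊗ₜ X.left.presheaf.map (homOfLE inf_le_left).op s)
      (Φlm : A ⊗[k] Γ(X.left, (U l).1 ⊓ (U m).1) →ₐ[A] A ⊗[k] Γ(X.left, (U j).1 ⊓ (U l).1 ⊓ (U m).1))
      (_ : ∀ a s, Φlm (a ⊗ₜ s) = a ⊗ₜ X.left.presheaf.map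
        (homOfLE (le_inf (inf_le_left.trans inf_le_right) inf_le_right)).op s)
      (Φjm : A ⊗[k] Γ(X.left, (U j).1 ⊓ (U m).1) →ₐ[A] A ⊗[k] Γ(X.left, (U j).1 ⊓ (U l).1 ⊓ (U m).1))
      (_ : ∀ a s, Φjm (a ⊗ₜ s) = a ⊗ₜ X.left.presheaf.map
        (homOfLE (le_inf (inf_le_left.trans inf_le_left) inf_le_right)).op s)
      (ρjl ρlm ρjm : A ⊗[k] Γ(X.left, (U j).1 ⊓ (U l).1 ⊓ (U m).1) ≃ₐ[A]
        A ⊗[k] Γ(X.left, (U j).1 ⊓ (U l).1 ⊓ (U m).1)),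
      (∀ x, ρjl (Φjl x) = Φjl (ψ₁ j l x)) → (∀ x, ρlm (Φlm x) = Φlm (ψ₁ l m x)) →
      (∀ x, ρjm (Φjm x) = Φjm (ψ₁ j m x)) → ρlm * ρjl = ρjm)
    (hψσ : ∀ j l x, Algebra.TensorProduct.map (Ideal.Quotient.mkₐ k J) (AlgHom.id k Γ(X.left, (U j).1 ⊓ (U l).1)) (ψ₁ j l x) =
      transition (ε₁ j l) (ε₂ j l)
        (Algebra.TensorProduct.map (Ideal.Quotient.mkₐ k J) (AlgHom.id k Γ(X.left, (U j).1 ⊓ (U l).1)) x)) :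
    ∃ (𝒳 : AbelianSchemeOver (Spec (.of A))) (_ : 𝒳.IsOfRelDim g) (G : A₀.X.left ⟶ 𝒳.X.left),
      A₀.IsBaseChangeVia 𝒳 (Spec.map (CommRingCat.ofHom (Ideal.Quotient.mk J))) G := by
  -- the glued deformation over `A`, its structure map, smooth
  obtain ⟨q, hq, -⟩ := existsUnique_structureMap halg A U b hb ψ₁ 𝔫 h𝔫 hψ₁ hcoc₁
  haveI hsmooth : Smooth q := smooth_structureMap halg A U b hb ψ₁ 𝔫 h𝔫 hψ₁ hcoc₁ q hq
  -- the glued deformation over `A⧸J` of the transition data `φ`, its structure map, and `Ψ : Glue(φ) ≅ A₀.X`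
  obtain ⟨q₀, hq₀, -⟩ := existsUnique_structureMap halg (A ⧸ J) U b hb (fun j l => transition (ε₁ j l) (ε₂ j l)) 𝔫₀ h𝔫₀ hφ hcocφ
  obtain ⟨Ψ, -, hΨiso, hΨq⟩ := exists_glued_iso_of_transition π' halg halgA i₀ U' b' hb' U hU b hb e he ε₁ ε₂ hε₁ hε₂ 𝔫₀ h𝔫₀
    hπ'nil hU'cov hφ hcocφ q₀ hq₀
  -- G5: the reduction square `Φ : Glue(φ) → Glue(ψ₁)` over `Spec (A⧸J) → Spec A` is cartesian
  obtain ⟨Φ, -, -, hΦpb⟩ := exists_baseChangeMap_isPullback halg (Ideal.Quotient.mkₐ k J) U b hb ψ₁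
    (fun j l => transition (ε₁ j l) (ε₂ j l)) 𝔫 h𝔫 𝔫₀ h𝔫₀ hψ₁ hφ hcoc₁ hcocφ hψσ q hq q₀ hq₀
  -- `G := Ψ⁻¹ ≫ Φ : A₀.X → X'` is cartesian over `Spec (A⧸J) → Spec A`
  haveI := hΨiso
  have hsq : IsPullback (inv Ψ) A₀.X.hom q₀ (𝟙 _) :=
    IsPullback.of_horiz_isIso ⟨by rw [Category.comp_id, ← hΨq, IsIso.inv_hom_id_assoc]⟩
  have hG : IsPullback (inv Ψ ≫ Φ) A₀.X.hom q (Spec.map (CommRingCat.ofHom (Ideal.Quotient.mk J))) := by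
    have h := hsq.paste_horiz hΦpb
    rw [Category.id_comp] at h
    exact h
  -- properness of the lift (★ p794690) and the junction
  haveI : IsProper q := by
    haveI := A₀.isProper
    exact isProper_of_isPullback_specMap_quotientMk_of_ne_top hJ hG
  haveI hP : IsProper (Over.mk q : Over (Spec (.of A))).hom := ‹IsProper q›
  haveI hS : Smooth (Over.mk q : Over (Spec (.of A))).hom := hsmooth
  obtain ⟨GX, hgc, hdim, hbc⟩ := AbelianSchemeOver.exists_abelianSchemeOver_of_isPullback (X := Over.mk q) hJ hmJ hG hA₀
  exact ⟨_, hdim, inv Ψ ≫ Φ, hbc⟩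

end Literature.AlgebraicGeometry.AbelianSchemes

end
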